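import Literature.AnabelianGeometry.AbsoluteAnabelian.AbsTopII.SemiEllipticTorsionFree
import Literature.AnabelianGeometry.AbsoluteAnabelian.AbsTopII.EllipticCuspidalizationComparisonPrimeProofs
import HarnessLib

/-!
# [AbsTopII] Cor 3.3 (ii) over a class `𝒟` with PRINT-FAITHFUL torsion-freeness — successors of
# `EllipticModel.Cor_3_3_ii` (F-0290) and of the datum retype `EllipticDatumModel.Cor_3_3_ii'`, and the
# print-faithful READING of the output field `EllipticCuspidalization.torsionFree_PiD` (F-0293 feed)

S. Mochizuki, *Topics in Absolute Anabelian Geometry II: Decomposition Groups and Endomorphisms*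
[AbsTopII] (bib `MochizukiAbsTopII2013`; kurims manuscript `paper:url-585b8d0ad0d9`, cell render
`HOME/lit/renders/AbsTopII-kurims-url-585b8d0ad0d9/p0068.txt` l.7–11), §3, Corollary 3.3 (ii) p. 68:
"… may be characterized 'group-theoretically' as the collection of open subgroups `J ⊆ Π_C` of index
`2` such that `J ∩ Δ_C` [where `Δ_C := Ker(Π_C ↠ G')`] is torsion-free [i.e., the covering determined
by `J` is a scheme — cf. [AbsTopI], Lemma 4.1, (iv)]."

WHY THIS FILE (cell abc-iut, row «TORSIONFREE-SUCCESSOR», abc-iut-L4-lead m151 (6); seat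
abc-iut-L4-t4 gen 12; file 2 of the row, sequel of `SemiEllipticTorsionFree.lean`).  FINDING
T1g11-F1 (abc-iut-L5-t1): the landed right-hand side `semiEllipticDoubleCoverSubgroups` renders
"torsion-free" by Mathlib's UNIQUE-ROOTS class `IsMulTorsionFree`, false for the free profinite
`Δ_D` of a once-punctured elliptic curve (`Summit.ABC.IUTFork.not_isMulTorsionFree_of_isFreeProOn`);
the `(𝒟, M)`-relative named facts `EllipticModel.Cor_3_3_ii` (abc-iut-L4-t6, FACT-LIST F-0290) and
`EllipticDatumModel.Cor_3_3_ii'` (abc-iut-L4-t4, row «COR33-RETYPE») consume that right-hand side,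
and the OUTPUT structure `EllipticCuspidalization` (F-0293 feed) carries the field
`torsionFree_PiD : IsMulTorsionFree ↥(Π_D ⊓ Δ_C)`.  DEFS-freeze: nothing landed is edited; this file
mints, in NEW declarations only,
* `EllipticModel.Cor_3_3_iiTF`, `EllipticDatumModel.Cor_3_3_iiTF'` — the two named facts re-pointed
  at the print-faithful `semiEllipticDoubleCoverSubgroupsTF` («`∀ g : ↥(J ⊓ Δ_C), IsOfFinOrder g →
  g = 1`», the cell currency of abc-iut-L5-t1's `huniq⁰`);
* the readings `EllipticCuspidalization.torsionFree_PiD'` / `PiD_mem_semiEllipticDoubleCoverSubgroupsTF`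
  (the landed field IMPLIES print's clause — what consumers of F-0293's output should cite; the
  structure-level successor `EllipticCuspidalizationTF` is the row's phase 2);
* the (⊆)-halves the landed facts still supply (`Cor_3_3_ii.doubleCovers_subset_TF`,
  `Cor_3_3_ii'.doubleCoverSubgroups_subset_TF`), the reading `doubleCoverSubgroups_eq_TF_iff`, and
  the equivalences `cor_3_3_iiTF_iff_of_comm` / `cor_3_3_iiTF'_iff_of_comm` at ABELIAN `Δ_C` (so
  landed model witnesses with abelian `Δ` transfer verbatim).
NOTE (no implication either way in general): with `S ⊆ S_TF` the (⊆)-clause of the successor is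
WEAKER and the (⊇)-clause STRONGER than the predecessor's; consumers are re-derived at the successor
(`SemiEllipticTransportTF.lean`), not bridged.

HONEST FRAMING: statements about OUR typing; the successors are unproved named facts like their
predecessors; nothing here bears on [IUTchIII] Cor 3.12 or asserts that abc is proved or refuted.
No instance, no notation; axioms standard.
-/

noncomputable section

namespace Literature.AnabelianGeometry.AbsoluteAnabelian.AbsTopII

open FundamentalExtension

universe u

section Successors

open AbsTopI (ConstructionDataClass)

/-- **Reading of the OUTPUT structure's field (ii)**: the landed `EllipticCuspidalization.torsionFree_PiD`
(Mathlib unique-roots class) implies print's torsion-freeness of `Π_D ∩ Δ_C` — the print-faithful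
form consumers should cite (finding T1g11-F1; the field itself is unsatisfiable at genuine data,
`Summit.ABC.IUTFork.ellipticCuspidalization_not_surjective_S3`; its structure-level successor is the
phase-2 `EllipticCuspidalizationTF`). [cite: MochizukiAbsTopII2013, Cor 3.3 (ii) p.68] -/
theorem EllipticCuspidalization.torsionFree_PiD' {E : FundamentalExtension.{u}}
    (K : EllipticCuspidalization E) :
    ∀ g : ↥(K.PiD ⊓ K.core.geom), IsOfFinOrder g → g = 1 :=
  inf_geom_torsionFree_of_isMulTorsionFree K.torsionFree_PiD

/-- The OUTPUT's `Π_D` lies in the print-faithful right-hand side of Cor 3.3 (ii) for the core.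
[cite: MochizukiAbsTopII2013, Cor 3.3 (ii) p.68] -/
theorem EllipticCuspidalization.PiD_mem_semiEllipticDoubleCoverSubgroupsTF
    {E : FundamentalExtension.{u}} (K : EllipticCuspidalization E) :
    K.PiD ∈ semiEllipticDoubleCoverSubgroupsTF K.core :=
  ⟨K.isOpen_PiD, K.index_PiD, K.torsionFree_PiD'⟩

namespace EllipticModel

variable {𝒟 : ConstructionDataClass.{u}} (M : EllipticModel 𝒟)

/-- **Corollary 3.3 (ii)** p. 68 relative to `(𝒟, M)`, instance `G' = G`, PRINT-FAITHFUL successor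
of `EllipticModel.Cor_3_3_ii` (FACT-LIST F-0290; finding T1g11-F1): under the hypotheses, "the
collection of open subgroups `Π_D ⊆ Π_C` that arise from finite étale double coverings `D → C` that
exhibit `C` as semi-elliptic [cf. Remark 3.1.1] may be characterized 'group-theoretically' as the
collection of open subgroups `J ⊆ Π_C` of index `2` such that `J ∩ Δ_C` [where
`Δ_C := Ker(Π_C ↠ G')`] is torsion-free" — right-hand side `semiEllipticDoubleCoverSubgroupsTF`
(no nontrivial element of finite order).  -- TODO(general form): `G' ⊊ G`, as for the predecessor.
[cite: MochizukiAbsTopII2013, Cor 3.3 (ii) p.68] -/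
def Cor_3_3_iiTF : Prop :=
  𝒟.IsChainFull → 𝒟.RelIsomDGC →
    ∀ (b : 𝒟.Base) (X : (𝒟.datum b).Obj), M.IsCor33Member b X →
      M.doubleCovers b X = semiEllipticDoubleCoverSubgroupsTF (M.coreExt b X)

/-- What the landed `EllipticModel.Cor_3_3_ii` still gives for the successor: the (⊆) half.
[cite: MochizukiAbsTopII2013, Cor 3.3 (ii) p.68] -/
theorem Cor_3_3_ii.doubleCovers_subset_TF {M : EllipticModel 𝒟} (h : M.Cor_3_3_ii)
    (hfull : 𝒟.IsChainFull) (hrel : 𝒟.RelIsomDGC) {b : 𝒟.Base} {X : (𝒟.datum b).Obj}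
    (hX : M.IsCor33Member b X) :
    M.doubleCovers b X ⊆ semiEllipticDoubleCoverSubgroupsTF (M.coreExt b X) := by
  rw [h hfull hrel b X hX]
  exact semiEllipticDoubleCoverSubgroups_subset_TF _

/-- At models whose core `Δ_C` is ABELIAN the successor and the predecessor are EQUIVALENT.
[cite: MochizukiAbsTopII2013, Cor 3.3 (ii) p.68] -/
theorem cor_3_3_iiTF_iff_of_comm {M : EllipticModel 𝒟}
    (hΔ : ∀ (b : 𝒟.Base) (X : (𝒟.datum b).Obj), M.IsCor33Member b X →
      ∀ x ∈ (M.coreExt b X).geom, ∀ y ∈ (M.coreExt b X).geom, x * y = y * x) :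
    M.Cor_3_3_iiTF ↔ M.Cor_3_3_ii := by
  refine forall_congr' fun hfull => forall_congr' fun hrel => forall_congr' fun b =>
    forall_congr' fun X => forall_congr' fun hX => ?_
  rw [semiEllipticDoubleCoverSubgroupsTF_eq_of_comm _ (hΔ b X hX)]

end EllipticModel

namespace EllipticDatumModel

variable {𝒟 : ConstructionDataClass.{u}} (M : EllipticDatumModel 𝒟)

/-- **Corollary 3.3 (ii′)** p. 68 relative to the datum (abc-iut-L4-t4's COR33-RETYPE), instance
`G' = G`, PRINT-FAITHFUL successor of `EllipticDatumModel.Cor_3_3_ii'` (finding T1g11-F1): for every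
`k`-core `X → C` inside the datum, the double-covering subgroups COMPUTED FROM THE DATUM
(`doubleCoverSubgroups`) equal "the collection of open subgroups `J ⊆ Π_C` of index `2` such that
`J ∩ Δ_C` is torsion-free" — right-hand side `semiEllipticDoubleCoverSubgroupsTF`.
-- TODO(general form): `G' ⊊ G`. [cite: MochizukiAbsTopII2013, Cor 3.3 (ii) p.68] -/
def Cor_3_3_iiTF' : Prop :=
  𝒟.IsChainFull → 𝒟.RelIsomDGC →
    ∀ (b : 𝒟.Base) (X : (𝒟.datum b).Obj), M.IsCor33Member b X →
      ∀ (C : (𝒟.datum b).Obj) (f : (𝒟.datum b).Hom X C), M.IsFinEt f → M.IsCoreOf b C X →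
        M.doubleCoverSubgroups b C = semiEllipticDoubleCoverSubgroupsTF ((𝒟.datum b).ext C)

/-- **Reading of the successor (ii′)** at a datum core: the equation is EQUIVALENT to (⊆) "for every
finite étale double covering `D → C` by a once-punctured elliptic curve in the datum, `Π_D ∩ Δ_C` has
no nontrivial element of finite order" and (⊇) "every open `J ⊆ Π_C` of index `2` with `J ∩ Δ_C`
torsion-free arises from such a `D → C`". [cite: MochizukiAbsTopII2013, Cor 3.3 (ii) p.68] -/
theorem doubleCoverSubgroups_eq_TF_iff (b : 𝒟.Base) (C : (𝒟.datum b).Obj) :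
    M.doubleCoverSubgroups b C = semiEllipticDoubleCoverSubgroupsTF ((𝒟.datum b).ext C) ↔
      (∀ J ∈ M.doubleCoverSubgroups b C,
          ∀ g : ↥(J ⊓ ((𝒟.datum b).ext C).geom), IsOfFinOrder g → g = 1) ∧
        ∀ J ∈ semiEllipticDoubleCoverSubgroupsTF ((𝒟.datum b).ext C),
          J ∈ M.doubleCoverSubgroups b C := by
  constructor
  · intro h
    refine ⟨fun J hJ => ?_, fun J hJ => h ▸ hJ⟩
    rw [h] at hJ
    exact hJ.2.2
  · rintro ⟨h1, h2⟩
    ext J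
    exact ⟨fun hJ => ⟨M.isOpen_of_mem_doubleCoverSubgroups hJ,
      M.index_of_mem_doubleCoverSubgroups hJ, h1 J hJ⟩, h2 J⟩

/-- What the landed `Cor_3_3_ii'` still gives for the successor: the (⊆) half.
[cite: MochizukiAbsTopII2013, Cor 3.3 (ii) p.68] -/
theorem Cor_3_3_ii'.doubleCoverSubgroups_subset_TF {M : EllipticDatumModel 𝒟} (h : M.Cor_3_3_ii')
    (hfull : 𝒟.IsChainFull) (hrel : 𝒟.RelIsomDGC) {b : 𝒟.Base} {X C : (𝒟.datum b).Obj}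
    (hX : M.IsCor33Member b X) {f : (𝒟.datum b).Hom X C} (hf : M.IsFinEt f)
    (hcore : M.IsCoreOf b C X) :
    M.doubleCoverSubgroups b C ⊆ semiEllipticDoubleCoverSubgroupsTF ((𝒟.datum b).ext C) := by
  rw [h hfull hrel b X hX C f hf hcore]
  exact semiEllipticDoubleCoverSubgroups_subset_TF _

/-- At datum cores with ABELIAN `Δ_C` the successor (ii′) and the predecessor are EQUIVALENT.
[cite: MochizukiAbsTopII2013, Cor 3.3 (ii) p.68] -/
theorem cor_3_3_iiTF'_iff_of_comm {M : EllipticDatumModel 𝒟}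
    (hΔ : ∀ (b : 𝒟.Base) (C : (𝒟.datum b).Obj),
      ∀ x ∈ ((𝒟.datum b).ext C).geom, ∀ y ∈ ((𝒟.datum b).ext C).geom, x * y = y * x) :
    M.Cor_3_3_iiTF' ↔ M.Cor_3_3_ii' := by
  refine forall_congr' fun hfull => forall_congr' fun hrel => forall_congr' fun b =>
    forall_congr' fun X => forall_congr' fun hX => forall_congr' fun C => forall_congr' fun f =>
    forall_congr' fun hf => forall_congr' fun hcore => ?_
  rw [semiEllipticDoubleCoverSubgroupsTF_eq_of_comm _ (hΔ b C)]

end EllipticDatumModel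

end Successors

end Literature.AnabelianGeometry.AbsoluteAnabelian.AbsTopII

end
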